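import Literature.AlgebraicGeometry.Motives.AlgPoints
import Literature.AlgebraicGeometry.Motives.AlgPointsProofs
import HarnessLib

/-!
# The strong topology is compatible with fibre products (proof file)

Sibling proof file of `Literature/AlgebraicGeometry/Motives/AlgPoints.lean`. That file vendors as
a *named fact* `Literature.AlgebraicGeometry.Motives.AlgPoints.isHomeomorph_prodEquiv`: for `k`-schemes `X`, `Y` and a Hausdorff
topological field `L ⊇ k`, the bijection `AlgPoints.prodEquiv : (X ×ₖ Y)(L) ≃ X(L) × Y(L)` is a
homeomorphism for the strong topologies `AlgPoints.instTopologicalSpace`. This file **discharges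
that fact** (`Literature.AlgebraicGeometry.Motives.AlgPoints.isHomeomorph_prodEquiv_holds`) from Mathlib and the accepted
`AlgPoints` API (`AlgPoints.lean`; the point-set lemmas `AlgPoints.preimage_eq_top`,
`AlgPoints.eval_eq_appLE`, `AlgPoints.ΓSpecIso_hom_SpecMap_appLE_top` of `AlgPointsProofs.lean`;
the evaluation ring homomorphism `AlgPoints.evalRingHom` and `AlgPoints.isOpen_setOf_pt_mem` of
`Literature/NumberTheory/Transcendental/Analytification.lean`).

The printed source is B. Conrad, *Weil and Grothendieck approaches to adelic points*, Enseign.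
Math. (2) **58** (2012), 61–97: Prop. 2.1 (§2; p. 2 of the author's 21-page version) — for
affine `X` of finite type over a topological ring `R`, the topology on `X(R) ⊆ R^{Γ(X, 𝒪)}` is
«functorial in `X`, compatible with the formation of fiber products»; and Prop. 3.1 (§3; p. 4,
ibid.) — for `R` local with `Rˣ` open and inversion continuous (e.g. a Hausdorff topological
field) and `X` locally of finite type, the topology glued from affine charts is unique subject to
«functoriality, carrying closed (resp. open) immersions of schemes into embeddings (resp. open
embeddings) of topological spaces, compatibility with fiber products». The Lean fact concerns
Mumford's intrinsic description of the same topology (the coarsest one making all `U(L)` open and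
all regular functions `U(L) → L` continuous, *Red Book* I §10), for arbitrary `k`-schemes; the
finite-type hypotheses of the source play no role for products and are not assumed.

## Proof

Continuity of `prodEquiv` is functoriality (`AlgPoints.continuous_map`). For the inverse,
Conrad's chart-by-chart argument (affine case = weak topology of the coordinate ring, open
immersions give open embeddings, glue) is replaced by the following device.

* `Literature.AlgebraicGeometry.Motives.AlgPoints.continuous_of_family` (**families through `Spec C(S, L)` are continuous**): a map
  `ρ : S → Z(L)` from a topological space `S` is continuous as soon as there is a morphism
  `τ : Spec C(S, L) ⟶ Z` with `ρ s = τ ∘ Spec (ev_s)` for all `s`, where `ev_s : C(S, L) → L` is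
  evaluation at `s` (`AlgPoints.evalAt`). Indeed, near `s₀` a regular function `g` on
  `W ∋ ρ(s₀)` pulls back along `τ` to a section of `Spec C(S, L)` over a basic open
  `D(c) ∋ 𝔪_{s₀}` inside `τ⁻¹ W`, i.e. to a fraction `a / cⁿ` with `a, c ∈ C(S, L)`
  (`IsLocalization.surj`), so `s ↦ g(ρ s) = a(s) / c(s)ⁿ` (`AlgPoints.eval_eq_evalAtBasicOpen`,
  `AlgPoints.evalAtBasicOpen_algebraMap`) is continuous on the open set `{c ≠ 0} ∋ s₀`; this uses
  exactly that `L` is a topological field with `{0}` closed. (This is the basic-open/localization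
  step of Conrad's proof of Prop. 3.1, run on the parameter ring `C(S, L)` instead of on charts.)
* Conversely a *continuous* family `σ : S → U(L)` with `U = Spec A ⊆ X` affine is of this form:
  `a ↦ (s ↦ a(σ s))` is a ring map `A → C(S, L)` (`AlgPoints.familyHom`, pointwise the
  evaluation maps `AlgPoints.evalRingHom (σ s)`) and `Spec C(S, L) → Spec A = U ⊆ X`
  (`AlgPoints.familyMap`) restricts to `σ s` along `Spec (ev_s)`
  (`AlgPoints.specMap_evalAt_familyMap`, via `AlgPoints.specMap_evalRingHom_fromSpec`:
  `P = Spec (f ↦ f(P)) ≫ (U ⊆ X)` for `P ∈ U(L)`); it is a `k`-morphism with the constants as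
  structure map (`AlgPoints.familyMap_over`).
* `Literature.AlgebraicGeometry.Motives.AlgPoints.continuousOn_prodEquiv_symm`: for affine opens `U ⊆ X`, `V ⊆ Y` and
  `S = U(L) × V(L) ⊆ X(L) × Y(L)`, the two projections are continuous families; pairing the two
  interpolating morphisms gives `Spec C(S, L) ⟶ X ×ₖ Y` interpolating `prodEquiv.symm|_S`, which
  is therefore continuous. These `S` form an open cover of `X(L) × Y(L)`
  (`AlgPoints.isOpen_setOf_pt_mem`, `Scheme.isBasis_affineOpens`), whence
  `Literature.AlgebraicGeometry.Motives.AlgPoints.continuous_prodEquiv_symm` and `Literature.AlgebraicGeometry.Motives.AlgPoints.isHomeomorph_prodEquiv_holds`.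

## References

* B. Conrad, *Weil and Grothendieck approaches to adelic points*, Enseign. Math. (2) **58**
  (2012), 61–97, doi:10.4171/lem/58-1-3, Prop. 2.1 (§2, p. 2 of the author's version), Prop. 3.1
  (§3, p. 4 of the author's version), Remark 3.2.
  [ConradAdelicPoints2012]
* D. Mumford, *The Red Book of Varieties and Schemes*, I §10 (properties of the complex
  topology: (ii) `(X × Y)(ℂ) = X(ℂ) × Y(ℂ)` as topological spaces).
* R. Hartshorne, *Algebraic Geometry*, II Ex. 2.7, II Prop. 2.3, II Thm. 3.3.
-/

noncomputable section

universe u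

open CategoryTheory AlgebraicGeometry MonoidalCategory Topology

namespace Literature.AlgebraicGeometry.Motives

/-! ### Pulling back sections over basic opens (generic scheme lemmas) -/

/-- Pulling back along `f` a section `t|_{D(c)}` extended from `U` to the basic open `D(c) ⊆ U`
is pulling back `t` (Mathlib `Scheme.Hom.map_appLE`). [folklore] -/
theorem appLE_basicOpen_algebraMap {X' Y' : Scheme.{u}} (f : X' ⟶ Y') {U : Y'.Opens}
    (c t : Γ(Y', U)) {V : X'.Opens} (e : V ≤ f ⁻¹ᵁ Y'.basicOpen c) :
    f.appLE (Y'.basicOpen c) V e (algebraMap _ _ t) =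
      f.appLE U V (e.trans (f.preimage_mono (Y'.basicOpen_le c))) t := by
  rw [RingHom.algebraMap_toAlgebra, ← CommRingCat.comp_apply, Scheme.Hom.map_appLE]

/-- For `φ : R ⟶ A` and `t ∈ R = Γ(Spec R, ⊤)`: pulling back `t|_{D(c)}` along `Spec φ` (when
`Spec φ` lands in `D(c)`) gives `φ t ∈ A = Γ(Spec A, ⊤)` (`ΓSpecIso_hom_SpecMap_appLE_top`;
Hartshorne II Prop. 2.3). [folklore] -/
theorem ΓSpecIso_appLE_algebraMap {R A : CommRingCat.{u}} (φ : R ⟶ A) (c t : Γ(Spec R, ⊤))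
    (e : ⊤ ≤ Spec.map φ ⁻¹ᵁ (Spec R).basicOpen c) :
    (Scheme.ΓSpecIso A).hom ((Spec.map φ).appLE ((Spec R).basicOpen c) ⊤ e (algebraMap _ _ t)) =
      φ ((Scheme.ΓSpecIso R).hom t) := by
  rw [appLE_basicOpen_algebraMap]
  exact AlgPoints.ΓSpecIso_hom_SpecMap_appLE_top φ _ t

namespace AlgPoints

variable {k : Type u} [Field k] {X Y : SchemeOver k} {L : Type u} [Field L] [Algebra k L]

/-! ### Evaluation at an `L`-point as a morphism of affine schemes -/

/-- `eval_eq_appLE` for a morphism `q` propositionally equal to `P` (avoids dependent rewriting;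
Hartshorne II Ex. 2.7). [folklore] -/
theorem eval_eq_appLE_of_eq (P : AlgPoints X L) (U : X.left.Opens) (h : P.pt ∈ U)
    (f : Γ(X.left, U)) (q : Spec (.of L) ⟶ X.left) (hq : q = P.toSpecHom) (e : ⊤ ≤ q ⁻¹ᵁ U) :
    P.eval U h f = (Scheme.ΓSpecIso (.of L)).hom (q.appLE U ⊤ e f) := by
  subst hq
  exact eval_eq_appLE P U h f

/-- The evaluation ring homomorphism `AlgPoints.evalRingHom P U h : Γ(X, U) →+* L`, `f ↦ f(P)`
(`Literature/NumberTheory/Transcendental/Analytification.lean`), as a morphism of `CommRingCat`,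
is pull-back along `P : Spec L → X` followed by `Γ(Spec L, ⊤) = L` (`AlgPoints.eval_eq_appLE`;
Hartshorne II Ex. 2.7). [folklore] -/
theorem ofHom_evalRingHom (P : AlgPoints X L) (U : X.left.Opens) (h : P.pt ∈ U) :
    CommRingCat.ofHom (P.evalRingHom U h) =
      P.toSpecHom.appLE U ⊤ (P.preimage_eq_top h).ge ≫ (Scheme.ΓSpecIso (.of L)).hom := by
  ext f
  rw [CommRingCat.hom_ofHom, evalRingHom_apply, eval_eq_appLE, CommRingCat.comp_apply]
  rfl

/-- An `L`-point lying in an affine open `U = Spec A` is `Spec (f ↦ f(P)) ≫ (Spec A ⟶ X)`, with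
`f ↦ f(P)` the ring homomorphism `AlgPoints.evalRingHom P U h`
(Mathlib `IsAffineOpen.SpecMap_appLE_fromSpec`; Hartshorne II Ex. 2.7 and Prop. 2.3). [folklore] -/
theorem specMap_evalRingHom_fromSpec (P : AlgPoints X L) {U : X.left.Opens} (hU : IsAffineOpen U)
    (h : P.pt ∈ U) :
    Spec.map (CommRingCat.ofHom (P.evalRingHom U h)) ≫ hU.fromSpec = P.toSpecHom := by
  have := hU.SpecMap_appLE_fromSpec P.toSpecHom (isAffineOpen_top _) (P.preimage_eq_top h).ge
  rw [IsAffineOpen.fromSpec_top, Scheme.isoSpec_Spec_inv] at this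
  rw [ofHom_evalRingHom, Spec.map_comp, Category.assoc, this, ← Spec.map_comp_assoc,
    Iso.inv_hom_id, Spec.map_id, Category.id_comp]

/-! ### Continuous families of points and `Spec C(S, L)` -/

section EvalAt

variable (R : Type u) [CommSemiring R] [TopologicalSpace R] [IsTopologicalSemiring R]
  {S : Type u} [TopologicalSpace S]

/-- Evaluation at `s ∈ S` as a ring homomorphism `ev_s : C(S, R) →+* R`, for a topological
(semi)ring `R` (Mathlib `ContinuousMap.evalAlgHom` as a `RingHom`; `R` is explicit because it is
not determined by `s`). [folklore] -/
def evalAt (s : S) : C(S, R) →+* R :=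
  (ContinuousMap.evalAlgHom R R s).toRingHom

/-- `ev_s c = c s`. [folklore] -/
@[simp]
theorem evalAt_apply (s : S) (c : C(S, R)) : evalAt R s c = c s := rfl

end EvalAt

section Family

variable [TopologicalSpace L] [IsTopologicalRing L] {S : Type u} [TopologicalSpace S]

variable (σ : S → AlgPoints X L) (hσ : Continuous σ) (U : X.left.Opens) (hσU : ∀ s, (σ s).pt ∈ U)

omit [IsTopologicalRing L] in
include hσ in
/-- Along a continuous family `σ : S → U(L)`, every regular function `a ∈ Γ(X, U)` gives a
continuous function `s ↦ a(σ s)` (definition of the strong topology; Mumford, *Red Book*,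
I.10). [folklore] -/
theorem continuous_eval_comp (a : Γ(X.left, U)) :
    Continuous fun s => (σ s).eval U (hσU s) a := by
  rw [continuous_def]
  intro V hV
  have : (fun s => (σ s).eval U (hσU s) a) ⁻¹' V = σ ⁻¹' basicSet U a V :=
    Set.ext fun s => ⟨fun h => ⟨hσU s, h⟩, fun ⟨_, h⟩ => h⟩
  rw [this]
  exact (isOpen_basicSet U a hV).preimage hσ

/-- For a continuous family `σ : S → U(L)`, the ring homomorphism `Γ(X, U) →+* C(S, L)`,
`a ↦ (s ↦ a(σ s))`; followed by evaluation at `s` it is the evaluation ring homomorphism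
`AlgPoints.evalRingHom (σ s) U _` of `Analytification.lean` (`evalAt_comp_familyHom`), which
gives the ring-homomorphism axioms pointwise. [folklore] -/
def familyHom : Γ(X.left, U) →+* C(S, L) where
  toFun a := ⟨fun s => (σ s).eval U (hσU s) a, continuous_eval_comp σ hσ U hσU a⟩
  map_one' := ContinuousMap.ext fun s => map_one ((σ s).evalRingHom U (hσU s))
  map_mul' a b := ContinuousMap.ext fun s => map_mul ((σ s).evalRingHom U (hσU s)) a b
  map_zero' := ContinuousMap.ext fun s => map_zero ((σ s).evalRingHom U (hσU s))
  map_add' a b := ContinuousMap.ext fun s => map_add ((σ s).evalRingHom U (hσU s)) a b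

/-- `familyHom σ _ U _ a s = a(σ s)`. [folklore] -/
@[simp]
theorem familyHom_apply_apply (a : Γ(X.left, U)) (s : S) :
    familyHom σ hσ U hσU a s = (σ s).eval U (hσU s) a := rfl

/-- `ev_s ∘ familyHom σ = AlgPoints.evalRingHom (σ s)`, evaluation at `σ s`. [folklore] -/
theorem evalAt_comp_familyHom (s : S) :
    CommRingCat.ofHom (familyHom σ hσ U hσU) ≫ CommRingCat.ofHom (evalAt L s) =
      CommRingCat.ofHom ((σ s).evalRingHom U (hσU s)) := by
  ext a
  simp only [CommRingCat.hom_comp, CommRingCat.hom_ofHom, RingHom.coe_comp, Function.comp_apply,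
    evalAt_apply, familyHom_apply_apply, evalRingHom_apply]

variable (hU : IsAffineOpen U)

/-- For `U ⊆ X` affine and a continuous family `σ : S → U(L)`, the morphism
`Spec C(S, L) ⟶ Spec Γ(X, U) = U ⟶ X` interpolating the family (a "`C(S, L)`-valued point"
of `X`). [folklore] -/
def familyMap : Spec (.of C(S, L)) ⟶ X.left :=
  Spec.map (CommRingCat.ofHom (familyHom σ hσ U hσU)) ≫ hU.fromSpec

/-- The restriction of `familyMap σ` along `Spec (ev_s) : Spec L ⟶ Spec C(S, L)` is the point
`σ s`. [folklore] -/
theorem specMap_evalAt_familyMap (s : S) :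
    Spec.map (CommRingCat.ofHom (evalAt L s)) ≫ familyMap σ hσ U hσU hU = (σ s).toSpecHom := by
  rw [familyMap, ← Category.assoc, ← Spec.map_comp, evalAt_comp_familyHom,
    specMap_evalRingHom_fromSpec]

/-- `familyMap σ` is a morphism over `k`: its structure map `k → C(S, L)` (which exists as
`Spec` is fully faithful) consists of constant functions, because each `σ s` is a `k`-morphism
and `C(S, L) → ∏ₛ L` is injective. [folklore] -/
theorem familyMap_over (ψ : CommRingCat.of k ⟶ CommRingCat.of C(S, L))
    (hψ : Spec.map ψ = familyMap σ hσ U hσU hU ≫ X.hom) (c : k) (s : S) :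
    ψ c s = algebraMap k L c := by
  have h1 : Spec.map (ψ ≫ CommRingCat.ofHom (evalAt L s)) =
      Spec.map (CommRingCat.ofHom (algebraMap k L)) := by
    rw [Spec.map_comp, hψ, ← Category.assoc, specMap_evalAt_familyMap]
    exact Over.w (σ s)
  have h2 := congrArg (fun φ => φ.hom c) (Spec.map_injective h1)
  simpa using h2

end Family

/-! ### Families through `Spec C(S, L)` are continuous -/

section Continuity

variable [TopologicalSpace L] [IsTopologicalRing L] {S : Type u} [TopologicalSpace S]

omit [Algebra k L] in
variable (L) in
/-- The `L`-rational closed point `𝔪_s = ker (ev_s)` of `Spec C(S, L)` attached to `s ∈ S`,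
as the image of `Spec (ev_s) : Spec L ⟶ Spec C(S, L)`. [folklore] -/
def closedPt (s : S) : Spec (.of C(S, L)) :=
  Spec.map (CommRingCat.ofHom (evalAt L s)) (IsLocalRing.closedPoint L)

omit [Algebra k L] in
/-- `𝔪_s ∈ D(c) ↔ c(s) ≠ 0` for `c ∈ C(S, L) = Γ(Spec C(S, L), ⊤)`. [folklore] -/
theorem closedPt_mem_basicOpen_iff (c : Γ(Spec (.of C(S, L)), ⊤)) (s : S) :
    closedPt L s ∈ (Spec (.of C(S, L))).basicOpen c ↔
      (Scheme.ΓSpecIso (.of C(S, L))).hom c s ≠ 0 := by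
  rw [basicOpen_eq_of_affine']
  change PrimeSpectrum.comap (evalAt L s) (IsLocalRing.closedPoint L) ∈
      PrimeSpectrum.basicOpen ((Scheme.ΓSpecIso (.of C(S, L))).hom c) ↔ _
  rw [PrimeSpectrum.mem_basicOpen, PrimeSpectrum.comap_asIdeal, Ideal.mem_comap,
      IsLocalRing.closedPoint, IsLocalRing.mem_maximalIdeal, mem_nonunits_iff, not_not,
      isUnit_iff_ne_zero, evalAt_apply]

omit [Algebra k L] in
/-- Evaluation at `s` of sections of `Spec C(S, L)` over a basic open `D(c) ∋ 𝔪_s`: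
`Γ(Spec C(S, L), D(c)) ⟶ Γ(Spec L, ⊤) = L`, pull-back along `Spec (ev_s)`. [folklore] -/
def evalAtBasicOpen (c : Γ(Spec (.of C(S, L)), ⊤)) (s : S)
    (hs : closedPt L s ∈ (Spec (.of C(S, L))).basicOpen c) :
    Γ(Spec (.of C(S, L)), (Spec (.of C(S, L))).basicOpen c) ⟶ CommRingCat.of L :=
  (Spec.map (CommRingCat.ofHom (evalAt L s))).appLE ((Spec (.of C(S, L))).basicOpen c) ⊤
      (Scheme.preimage_eq_top_of_closedPoint_mem
        (Spec.map (CommRingCat.ofHom (evalAt L s))) hs).ge ≫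
    (Scheme.ΓSpecIso (.of L)).hom

omit [Algebra k L] in
/-- On sections `t|_{D(c)}` coming from `t ∈ C(S, L)`, `evalAtBasicOpen c s` is `t ↦ t(s)`. [folklore] -/
theorem evalAtBasicOpen_algebraMap (c t : Γ(Spec (.of C(S, L)), ⊤)) (s : S)
    (hs : closedPt L s ∈ (Spec (.of C(S, L))).basicOpen c) :
    evalAtBasicOpen c s hs (algebraMap _ _ t) = (Scheme.ΓSpecIso (.of C(S, L))).hom t s := by
  rw [evalAtBasicOpen, CommRingCat.comp_apply, ΓSpecIso_appLE_algebraMap]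
  rfl

variable {Z : SchemeOver k} (τ : Spec (.of C(S, L)) ⟶ Z.left) (ρ : S → AlgPoints Z L)
    (hρ : ∀ s, Spec.map (CommRingCat.ofHom (evalAt L s)) ≫ τ = (ρ s).toSpecHom)

include hρ in
/-- If `ρ s = τ ∘ Spec (ev_s)`, then `τ (𝔪_s)` is the point of `Z` underlying `ρ s`. [folklore] -/
theorem apply_closedPt (s : S) : τ (closedPt L s) = (ρ s).pt := by
  change _ = (ρ s).toSpecHom (IsLocalRing.closedPoint L)
  rw [← hρ s, Scheme.Hom.comp_apply]
  rfl

include hρ in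
/-- If `ρ s = τ ∘ Spec (ev_s)` and `D(c) ⊆ τ ⁻¹ W` contains `𝔪_s`, then for `g ∈ Γ(Z, W)` the
value `g(ρ s)` is the evaluation at `s` of the pulled-back section `τ^* g ∈ Γ(Spec C(S, L), D(c))`
(functoriality of pull-back, Mathlib `Scheme.Hom.appLE_comp_appLE`). [folklore] -/
theorem eval_eq_evalAtBasicOpen (W : Z.left.Opens) (g : Γ(Z.left, W))
    (c : Γ(Spec (.of C(S, L)), ⊤)) (hcW : (Spec (.of C(S, L))).basicOpen c ≤ τ ⁻¹ᵁ W) (s : S)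
    (hs : closedPt L s ∈ (Spec (.of C(S, L))).basicOpen c) :
    ∃ hW : (ρ s).pt ∈ W, (ρ s).eval W hW g =
      evalAtBasicOpen c s hs (τ.appLE W ((Spec (.of C(S, L))).basicOpen c) hcW g) := by
  have hW' : τ (closedPt L s) ∈ W := hcW hs
  have hW : (ρ s).pt ∈ W := by rw [← apply_closedPt τ ρ hρ s]; exact hW'
  refine ⟨hW, ?_⟩
  have e' : ⊤ ≤ (Spec.map (CommRingCat.ofHom (evalAt L s)) ≫ τ) ⁻¹ᵁ W :=
    (Scheme.preimage_eq_top_of_closedPoint_mem (Spec.map (CommRingCat.ofHom (evalAt L s)) ≫ τ)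
      (U := W) (by rw [Scheme.Hom.comp_apply]; exact hW')).ge
  rw [eval_eq_appLE_of_eq (ρ s) W hW g _ (hρ s) e',
    ← Scheme.Hom.appLE_comp_appLE _ τ W ((Spec (.of C(S, L))).basicOpen c) ⊤ hcW
      (Scheme.preimage_eq_top_of_closedPoint_mem
        (Spec.map (CommRingCat.ofHom (evalAt L s))) hs).ge,
    CategoryTheory.comp_apply, evalAtBasicOpen, CategoryTheory.comp_apply]

include hρ in
/-- **Families through `Spec C(S, L)` are continuous.** Let `L` be a topological field with
continuous inversion on `Lˣ` and `{0}` closed, `τ : Spec C(S, L) ⟶ Z` a morphism of schemes and `ρ : S → Z(L)` a family of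
`L`-points with `ρ s = τ ∘ Spec (ev_s)` for all `s`. Then `ρ` is continuous for the strong
topology: near `s₀`, a regular function `g` on `W ∋ ρ(s₀)` pulls back to a section of
`Spec C(S, L)` over a basic open `D(c) ∋ 𝔪_{s₀}` inside `τ ⁻¹ W`, i.e. to a fraction `a / cⁿ` with
`a, c ∈ C(S, L)`, so `s ↦ g(ρ s) = a(s) / c(s)ⁿ` is continuous on the open set `{c ≠ 0} ∋ s₀`
(the device replacing the chart-by-chart argument of Conrad, *loc. cit.*, proof of Prop. 3.1). [folklore] -/
theorem continuous_of_family [ContinuousInv₀ L] [T1Space L] : Continuous ρ := by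
  refine continuous_generateFrom_iff.mpr ?_
  rintro _ ⟨W, g, V₀, hV₀, rfl⟩
  rw [isOpen_iff_forall_mem_open]
  rintro s₀ ⟨h₀, hg₀⟩
  have hx₀ : closedPt L s₀ ∈ τ ⁻¹ᵁ W := by
    change τ (closedPt L s₀) ∈ W
    rw [apply_closedPt τ ρ hρ]
    exact h₀
  -- a basic open `D(c) ∋ 𝔪_{s₀}` inside `τ ⁻¹ W`, and `τ^* g = a / c ^ n` on it
  obtain ⟨c, hcW, hc₀⟩ :=
    (isAffineOpen_top (Spec (.of C(S, L)))).exists_basicOpen_le ⟨closedPt L s₀, hx₀⟩ trivial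
  obtain ⟨⟨a, m⟩, hm⟩ := IsLocalization.surj (Submonoid.powers c)
    (τ.appLE W ((Spec (.of C(S, L))).basicOpen c) hcW g)
  obtain ⟨n, hn⟩ := (Submonoid.mem_powers_iff _ _).mp m.2
  -- the continuous functions underlying `c` and `a`
  set cf : C(S, L) := (Scheme.ΓSpecIso (.of C(S, L))).hom c with hcf
  set af : C(S, L) := (Scheme.ΓSpecIso (.of C(S, L))).hom a with haf
  -- the value `g(ρ s) = a(s) / c(s) ^ n` on `{c ≠ 0}`
  have eval_eq : ∀ s, cf s ≠ 0 → ∃ hW : (ρ s).pt ∈ W, (ρ s).eval W hW g = af s / cf s ^ n := by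
    intro s hs
    have hxs : closedPt L s ∈ (Spec (.of C(S, L))).basicOpen c :=
      (closedPt_mem_basicOpen_iff c s).mpr hs
    obtain ⟨hW, he⟩ := eval_eq_evalAtBasicOpen τ ρ hρ W g c hcW s hxs
    refine ⟨hW, ?_⟩
    rw [he]
    have key := congrArg (fun z => evalAtBasicOpen c s hxs z) hm
    simp only [map_mul, ← hn, map_pow] at key
    rw [evalAtBasicOpen_algebraMap, evalAtBasicOpen_algebraMap] at key
    exact eq_div_of_mul_eq (pow_ne_zero n hs) key
  -- the neighbourhood `{c ≠ 0} ∩ (a / cⁿ) ⁻¹ V₀` of `s₀`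
  refine ⟨{s | cf s ≠ 0} ∩ (fun s => af s / cf s ^ n) ⁻¹' V₀, ?_, ?_, ?_⟩
  · rintro s ⟨hs, hV⟩
    obtain ⟨hW, he⟩ := eval_eq s hs
    exact ⟨hW, he ▸ hV⟩
  · refine ContinuousOn.isOpen_inter_preimage ?_ ?_ hV₀
    · exact (af.continuous.continuousOn).div ((cf.continuous.pow n).continuousOn)
        (fun s hs => pow_ne_zero n hs)
    · exact isOpen_compl_singleton.preimage cf.continuous
  · have hs₀ : cf s₀ ≠ 0 := (closedPt_mem_basicOpen_iff c s₀).mp hc₀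
    obtain ⟨hW, he⟩ := eval_eq s₀ hs₀
    exact ⟨hs₀, by rw [Set.mem_preimage, ← he]; exact hg₀⟩

end Continuity

/-! ### The product -/

section Product

variable [TopologicalSpace L] [IsTopologicalDivisionRing L] [T1Space L]

/-- `prodEquiv.symm` is continuous on `U(L) × V(L)` for affine opens `U ⊆ X`, `V ⊆ Y`: the two
projections of `S = U(L) × V(L)` are continuous families, hence give
`Spec C(S, L)`-valued points of `U` and `V` over `k`, whose pairing `Spec C(S, L) ⟶ X ×ₖ Y`
interpolates `prodEquiv.symm|_S`; conclude by `continuous_of_family` (Conrad, *loc. cit.*,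
Prop. 2.1 / Prop. 3.1, compatibility with fibre products). [folklore] -/
theorem continuousOn_prodEquiv_symm {U : X.left.Opens} (hU : IsAffineOpen U) {V : Y.left.Opens}
    (hV : IsAffineOpen V) :
    ContinuousOn (fun PQ : AlgPoints X L × AlgPoints Y L => prodEquiv.symm PQ)
      {PQ | PQ.1.pt ∈ U ∧ PQ.2.pt ∈ V} := by
  rw [continuousOn_iff_continuous_restrict]
  -- the parameter space and the two families
  set S := {PQ : AlgPoints X L × AlgPoints Y L // PQ.1.pt ∈ U ∧ PQ.2.pt ∈ V} with hS
  let σ₁ : S → AlgPoints X L := fun s => s.1.1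
  let σ₂ : S → AlgPoints Y L := fun s => s.1.2
  have hσ₁ : Continuous σ₁ := continuous_fst.comp continuous_subtype_val
  have hσ₂ : Continuous σ₂ := continuous_snd.comp continuous_subtype_val
  have hσ₁U : ∀ s, (σ₁ s).pt ∈ U := fun s => s.2.1
  have hσ₂V : ∀ s, (σ₂ s).pt ∈ V := fun s => s.2.2
  let f₁ := familyMap σ₁ hσ₁ U hσ₁U hU
  let f₂ := familyMap σ₂ hσ₂ V hσ₂V hV
  -- both families are over `k`
  have hover : f₁ ≫ X.hom = f₂ ≫ Y.hom := by
    obtain ⟨ψ₁, hψ₁⟩ := Spec.map_surjective (f₁ ≫ X.hom)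
    obtain ⟨ψ₂, hψ₂⟩ := Spec.map_surjective (f₂ ≫ Y.hom)
    rw [← hψ₁, ← hψ₂]
    congr 1
    ext c s
    rw [familyMap_over σ₁ hσ₁ U hσ₁U hU ψ₁ hψ₁ c s, familyMap_over σ₂ hσ₂ V hσ₂V hV ψ₂ hψ₂ c s]
  -- the interpolating morphism `Spec C(S, L) ⟶ X ×ₖ Y`
  let τ : Spec (.of C(S, L)) ⟶ (X ⊗ Y).left := Limits.pullback.lift f₁ f₂ hover
  refine continuous_of_family τ _ fun s => ?_
  change Spec.map (CommRingCat.ofHom (evalAt L s)) ≫ Limits.pullback.lift f₁ f₂ hover =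
    Limits.pullback.lift (σ₁ s).toSpecHom (σ₂ s).toSpecHom
      ((Over.w (σ₁ s)).trans (Over.w (σ₂ s)).symm)
  apply Limits.pullback.hom_ext
  · rw [Category.assoc, Limits.pullback.lift_fst, Limits.pullback.lift_fst]
    exact specMap_evalAt_familyMap σ₁ hσ₁ U hσ₁U hU s
  · rw [Category.assoc, Limits.pullback.lift_snd, Limits.pullback.lift_snd]
    exact specMap_evalAt_familyMap σ₂ hσ₂ V hσ₂V hV s

/-- `prodEquiv.symm : X(L) × Y(L) → (X ×ₖ Y)(L)` is continuous, for `L` a topological field with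
`{0}` closed and arbitrary `k`-schemes `X`, `Y`: the sets `U(L) × V(L)` for affine opens `U`,
`V` form an open cover on which it is continuous (Conrad, *loc. cit.*, Prop. 3.1). [folklore] -/
theorem continuous_prodEquiv_symm :
    Continuous (prodEquiv.symm : AlgPoints X L × AlgPoints Y L → AlgPoints (X ⊗ Y) L) := by
  rw [continuous_iff_continuousAt]
  rintro ⟨P, Q⟩
  obtain ⟨_, ⟨U, hU, rfl⟩, hPU, -⟩ := X.left.isBasis_affineOpens.exists_subset_of_mem_open
    (Set.mem_univ P.pt) isOpen_univ
  obtain ⟨_, ⟨V, hV, rfl⟩, hQV, -⟩ := Y.left.isBasis_affineOpens.exists_subset_of_mem_open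
    (Set.mem_univ Q.pt) isOpen_univ
  refine (continuousOn_prodEquiv_symm hU hV).continuousAt (IsOpen.mem_nhds ?_ ⟨hPU, hQV⟩)
  exact (isOpen_setOf_pt_mem U).prod (isOpen_setOf_pt_mem V)

omit [IsTopologicalDivisionRing L] [T1Space L] in
/-- `prodEquiv : (X ×ₖ Y)(L) → X(L) × Y(L)` is continuous (its components are `map` of the
projections; any `[TopologicalSpace L]`). [folklore] -/
theorem continuous_prodEquiv :
    Continuous (prodEquiv : AlgPoints (X ⊗ Y) L → AlgPoints X L × AlgPoints Y L) :=
  (continuous_map (CartesianMonoidalCategory.fst X Y)).prodMk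
    (continuous_map (CartesianMonoidalCategory.snd X Y))

end Product

/-- **Discharge of `isHomeomorph_prodEquiv`.** For a Hausdorff topological field `L` over `k`
and arbitrary `k`-schemes `X`, `Y`, the bijection `prodEquiv : (X ×ₖ Y)(L) ≃ X(L) × Y(L)` is a
homeomorphism for the strong topologies (Conrad, *Weil and Grothendieck approaches to adelic
points*, Enseign. Math. 58 (2012): Prop. 2.1 (§2; p. 2 of the author's version), affine schemes
of finite type over a topological ring; Prop. 3.1 (§3; p. 4, ibid.), schemes locally of finite
type over a local topological ring `R` with `Rˣ` open and inversion continuous. The finite-type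
hypotheses of the source are not needed for compatibility with fibre products and are not assumed
here; only continuity of `+`, `*`, `⁻¹` and closedness of `{0}` in `L` are used).
[cite: ConradAdelicPoints2012, Prop. 2.1 and Prop. 3.1] -/
theorem isHomeomorph_prodEquiv_holds : isHomeomorph_prodEquiv (X := X) (Y := Y) (L := L) := by
  intro _ _ _
  exact (Homeomorph.mk prodEquiv continuous_prodEquiv continuous_prodEquiv_symm).isHomeomorph

end AlgPoints

end Literature.AlgebraicGeometry.Motives
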